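import Literature.Barriers.Parity.SiegelZeroDichotomyChowlaStep3Cutoff
import Literature.Barriers.Parity.SiegelZeroDichotomyChowlaStep3Local
import Literature.Barriers.Parity.SiegelZeroDichotomyChowlaTypeI
import HarnessLib

/-!
# Step (iii) of Tao–Teräväinen at `k = 0`: `λ♭_Siegel(n) = ∫ β_t(n) f(t) dt` and
# `|λ♭_Siegel(n)| ≤ ∫ |β_t(n)| |f(t)| dt`

Topic `Literature/Barriers/Parity`, sub-namespace `TaoTeravainen`; a file of the proof DAG of
`Literature.Barriers.Parity.TaoTeravainen2021_chowla`, towards `TaoTeravainen2021_lemma61` /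
`TaoTeravainen2021_prop63_k0` (Lemma 6.1 / Proposition 6.3 at `k = 0`). Everything here is PROVED.

In the proof of Lemma 6.1 the source writes: "From (6.8), (6.9) we have
`β(n) = ∫_ℝ β_t(n) f(t) dt` where (6.11) `β_t := (λ ∗ μχ)_(≤R) (·)^{(1+it)/log R} ∗ χ_(≤R)`.
From (6.7) and the triangle inequality we then have
`λ♭_Siegel(n) ≤ ∫_ℝ |β_t| ∗ 1_(>R)(n) |f(t)| dt`." [cite: TaoTeravainen2021, §6, proof of Lemma 6.1 ((6.7)–(6.11))]

Here, with the objects of the sibling files — `liouvilleSiegelFlat` ((6.3),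
`SiegelZeroDichotomyChowlaStep3Model.lean`), the Fourier data `cutoffFourier ψ κ` and the
representation `IsSmoothCutoff.one_sub_eq_exp_mul_integral` ((6.9),
`SiegelZeroDichotomyChowlaStep3Cutoff.lean`), and the twisted coefficients `betaAF χ N s`
((6.11) convolved with the full `χ`, `SiegelZeroDichotomyChowlaStep3Local.lean`):

* `sParam R t = (1 + 2πit)/log R` and `natCast_cpow_sParam`:
  `d^{s_t} = e^{u} e^{2πi t u}` for `u = log d / log R`;
* `one_sub_cutoff_eq_integral` — `1 - ψ(log_D d) = ∫ d^{s_t} f(t) dt` for `d ≥ 1`, `1 < R ≤ D`,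
  `κ = log R / log D` ((6.9) at `u = log_R d`);
* **`liouvilleSiegelFlat_eq_integral`** — `λ♭_Siegel(n) = ∫ β_{s_t}(n) f(t) dt` (finite sum and
  integral commute; the integrand of each divisor pair is a bounded continuous function times the
  integrable `f`);
* **`abs_liouvilleSiegelFlat_le_integral`** — `|λ♭_Siegel(n)| ≤ ∫ ‖β_{s_t}(n)‖ ‖f(t)‖ dt`, with the
  integrability of the right-hand side (`integrable_norm_betaAF_mul`), and the multiplicative
  evaluation `norm_betaAF_eq_prod`: `‖β_s(n)‖ = ∏_{p^k ∥ n} ‖β_s(p^k)‖`.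
  [cite: TaoTeravainen2021, §6, proof of Lemma 6.1 ((6.7)–(6.11))]
-/

noncomputable section

open Real MeasureTheory Finset Complex
open scoped FourierTransform

namespace Literature.Barriers.Parity.TaoTeravainen

variable {q : ℕ} (χ : DirichletCharacter ℂ q) {ψ : ℝ → ℝ}

/-! ### The complex exponent `s_t = (1 + 2πit)/log R` -/

/-- The exponent `s_t = (1 + 2πit)/log R` of (6.11) (with the source's `t` rescaled by `2π`, as in
`cutoffFourier`). [cite: TaoTeravainen2021, §6 (6.11)] -/
def sParam (R t : ℝ) : ℂ :=
  (1 + 2 * π * t * Complex.I) / Real.log R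

/-- `Re s_t = 1/log R`. [cite: TaoTeravainen2021, §6 (6.11)] -/
theorem sParam_re (R t : ℝ) : (sParam R t).re = 1 / Real.log R := by
  unfold sParam
  rw [Complex.div_ofReal_re]
  simp

/-- `Im s_t = 2πt/log R`. [cite: TaoTeravainen2021, §6 (6.11)] -/
theorem sParam_im (R t : ℝ) : (sParam R t).im = 2 * π * t / Real.log R := by
  unfold sParam
  rw [Complex.div_ofReal_im]
  simp

/-- `0 ≤ Re s_t` for `R ≥ 1`. [folklore] -/
theorem sParam_re_nonneg {R : ℝ} (hR : 1 ≤ R) (t : ℝ) : 0 ≤ (sParam R t).re := by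
  rw [sParam_re]; exact div_nonneg zero_le_one (Real.log_nonneg hR)

/-- **`d^{s_t} = e^{u} · e^{2πi t u}`** with `u = log d/log R` (`d ≥ 1`). [folklore] -/
theorem natCast_cpow_sParam {d : ℕ} (hd : d ≠ 0) (R t : ℝ) :
    (d : ℂ) ^ sParam R t =
      Real.exp (Real.log d / Real.log R) *
        Complex.exp (↑(2 * π * (t * (Real.log d / Real.log R))) * Complex.I) := by
  have hd0 : (d : ℂ) ≠ 0 := by exact_mod_cast hd
  rw [Complex.cpow_def_of_ne_zero hd0, ← Complex.natCast_log, Complex.ofReal_exp, ← Complex.exp_add]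
  congr 1
  unfold sParam
  have hlog : ((Real.log d : ℝ) : ℂ) * ((1 + 2 * π * t * Complex.I) / (Real.log R : ℂ)) =
      ((Real.log d / Real.log R : ℝ) : ℂ) + ((2 * π * (t * (Real.log d / Real.log R)) : ℝ) : ℂ) *
        Complex.I := by
    push_cast
    ring
  exact hlog

/-- `‖d^{s}‖ = d^{Re s}` for `d ≥ 1`. [folklore] -/
theorem norm_natCast_cpow_of_ne_zero {d : ℕ} (hd : d ≠ 0) (s : ℂ) :
    ‖(d : ℂ) ^ s‖ = (d : ℝ) ^ s.re := by
  rw [Complex.norm_natCast_cpow_of_pos (Nat.pos_of_ne_zero hd)]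

/-! ### (6.9): the cutoff weight as an integral -/

/-- **(6.9) for the weight of `λ♭_Siegel`**: for `d ≥ 1` and `1 < R ≤ D`,
`1 - ψ(log d/log D) = ∫ d^{s_t} f(t) dt` with `f = cutoffFourier ψ (log R/log D)`
("`ψ_{>D}(n) = ∫_ℝ n^{(1+it)/log R} f(t) dt`"). [cite: TaoTeravainen2021, §6 (6.9)] -/
theorem one_sub_cutoff_eq_integral (hψ : IsSmoothCutoff ψ) {R D : ℝ} (hR : 1 < R) (hRD : R ≤ D)
    {d : ℕ} (hd : d ≠ 0) :
    ((1 - ψ (Real.log d / Real.log D) : ℝ) : ℂ) =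
      ∫ t : ℝ, (d : ℂ) ^ sParam R t * cutoffFourier ψ (Real.log R / Real.log D) t := by
  have hlogR : 0 < Real.log R := Real.log_pos hR
  have hlogD : 0 < Real.log D := Real.log_pos (hR.trans_le hRD)
  set κ : ℝ := Real.log R / Real.log D with hκ
  have hκ0 : 0 < κ := div_pos hlogR hlogD
  have hκ1 : κ ≤ 1 := (div_le_one hlogD).mpr (Real.log_le_log (by linarith) hRD)
  set u : ℝ := Real.log d / Real.log R with hu
  have hu0 : 0 ≤ u := div_nonneg (Real.log_natCast_nonneg d) hlogR.le
  have hκu : κ * u = Real.log d / Real.log D := by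
    rw [hκ, hu]; field_simp
  have h := hψ.one_sub_eq_exp_mul_integral hκ0 hκ1 hu0
  rw [hκu] at h
  rw [h, ← integral_const_mul]
  refine integral_congr_ae (Filter.Eventually.of_forall fun t => ?_)
  dsimp only
  rw [natCast_cpow_sParam hd R t, ← hu]
  ring

/-! ### `λ♭_Siegel(n) = ∫ β_{s_t}(n) f(t) dt` -/

/-- `f` is integrable. [cite: TaoTeravainen2021, §6 (6.10)] -/
theorem IsSmoothCutoff.integrable_cutoffFourier (hψ : IsSmoothCutoff ψ) {κ : ℝ} (hκ : 0 < κ)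
    (hκ1 : κ ≤ 1) : Integrable (cutoffFourier ψ κ) := by
  have h := hψ.integrable_pow_mul_norm_cutoffFourier 0 hκ hκ1
  simp only [pow_zero, one_mul] at h
  exact (integrable_norm_iff (hψ.continuous_cutoffFourier hκ hκ1).aestronglyMeasurable).mp h

/-- `t ↦ d^{s_t}` is continuous and bounded by `d^{1/log R}` in norm. [folklore] -/
theorem continuous_natCast_cpow_sParam {d : ℕ} (hd : d ≠ 0) (R : ℝ) :
    Continuous fun t : ℝ => (d : ℂ) ^ sParam R t := by
  have : (fun t : ℝ => (d : ℂ) ^ sParam R t) = fun t : ℝ => (Real.exp (Real.log d / Real.log R) : ℂ) *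
      Complex.exp (↑(2 * π * (t * (Real.log d / Real.log R))) * Complex.I) := by
    funext t; exact natCast_cpow_sParam hd R t
  rw [this]
  fun_prop

/-- **`λ♭_Siegel(n) = ∫ β_{s_t}(n) f(t) dt`** for `n ≥ 1`, `1 < R ≤ D`, quadratic `χ`
("`β(n) = ∫_ℝ β_t(n) f(t) dt`", with `λ♭_Siegel = β ∗ χ_(>R)` absorbed by convolving with the full
`χ` in `betaAF`). [cite: TaoTeravainen2021, §6 (6.7)–(6.11)] -/
theorem liouvilleSiegelFlat_eq_integral (hψ : IsSmoothCutoff ψ) {R D : ℝ} (hR : 1 < R) (hRD : R ≤ D)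
    (n : ℕ) :
    ((liouvilleSiegelFlat χ ψ R D n : ℝ) : ℂ) =
      ∫ t : ℝ, betaAF χ (⌊R⌋₊ + 1) (sParam R t) n * cutoffFourier ψ (Real.log R / Real.log D) t := by
  have hlogR : 0 < Real.log R := Real.log_pos hR
  have hlogD : 0 < Real.log D := Real.log_pos (hR.trans_le hRD)
  have hκ0 : 0 < Real.log R / Real.log D := div_pos hlogR hlogD
  have hκ1 : Real.log R / Real.log D ≤ 1 := (div_le_one hlogD).mpr (Real.log_le_log (by linarith) hRD)
  set f := cutoffFourier ψ (Real.log R / Real.log D) with hf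
  have hfint : Integrable f := hψ.integrable_cutoffFourier hκ0 hκ1
  -- each divisor pair contributes an integrable function of `t`
  set F : ℕ × ℕ → ℝ → ℂ := fun p t =>
    ((if p.1 ∈ (⌊R⌋₊ + 1).smoothNumbers then lamMuChi χ p.1 else 0 : ℝ) : ℂ) *
      (p.1 : ℂ) ^ sParam R t * (realChar χ p.2 : ℂ) * f t with hF
  have hFint : ∀ p ∈ n.divisorsAntidiagonal, Integrable (F p) := by
    intro p hp
    have hp1 : p.1 ≠ 0 := left_ne_zero_of_mul (by
      rw [(Nat.mem_divisorsAntidiagonal.mp hp).1]; exact (Nat.mem_divisorsAntidiagonal.mp hp).2)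
    refine hfint.bdd_mul (c := ‖((if p.1 ∈ (⌊R⌋₊ + 1).smoothNumbers then lamMuChi χ p.1 else 0 : ℝ)
      : ℂ)‖ * (p.1 : ℝ) ^ (1 / Real.log R) * 1) ?_ (Filter.Eventually.of_forall fun t => ?_)
    · exact ((continuous_const.mul (continuous_natCast_cpow_sParam hp1 R)).mul
        continuous_const).aestronglyMeasurable
    · rw [norm_mul, norm_mul, norm_natCast_cpow_of_ne_zero hp1, sParam_re]
      gcongr
      exact norm_realChar_le_one χ p.2
  -- pointwise: the sum of the `F p` is `β_{s_t}(n) f(t)`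
  have hsum : ∀ t, ∑ p ∈ n.divisorsAntidiagonal, F p t =
      betaAF χ (⌊R⌋₊ + 1) (sParam R t) n * f t := by
    intro t
    rw [betaAF_apply, Finset.sum_mul]
  -- the left-hand side, divisor pair by divisor pair
  have hlhs : ((liouvilleSiegelFlat χ ψ R D n : ℝ) : ℂ) = ∑ p ∈ n.divisorsAntidiagonal, ∫ t, F p t := by
    unfold liouvilleSiegelFlat
    push_cast
    refine Finset.sum_congr rfl fun p hp => ?_
    have hp1 : p.1 ≠ 0 := left_ne_zero_of_mul (by
      rw [(Nat.mem_divisorsAntidiagonal.mp hp).1]; exact (Nat.mem_divisorsAntidiagonal.mp hp).2)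
    by_cases hs : p.1 ∈ (⌊R⌋₊ + 1).smoothNumbers
    · simp only [hF, if_pos hs]
      have h1 := one_sub_cutoff_eq_integral hψ hR hRD hp1
      rw [← hf] at h1
      push_cast at h1 ⊢
      rw [h1, ← integral_const_mul, ← integral_mul_const]
      refine integral_congr_ae (Filter.Eventually.of_forall fun t => ?_)
      dsimp only
      ring
    · simp only [hF, if_neg hs]
      simp
  rw [hlhs, ← integral_finsetSum _ hFint]
  exact integral_congr_ae (Filter.Eventually.of_forall fun t => hsum t)

/-- The integrand `‖β_{s_t}(n)‖ ‖f(t)‖` is integrable. [cite: TaoTeravainen2021, §6 (6.10)–(6.11)] -/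
theorem integrable_norm_betaAF_mul (hψ : IsSmoothCutoff ψ) {R D : ℝ} (hR : 1 < R) (hRD : R ≤ D)
    (n : ℕ) :
    Integrable fun t : ℝ =>
      betaAF χ (⌊R⌋₊ + 1) (sParam R t) n * cutoffFourier ψ (Real.log R / Real.log D) t := by
  have hlogR : 0 < Real.log R := Real.log_pos hR
  have hlogD : 0 < Real.log D := Real.log_pos (hR.trans_le hRD)
  have hκ0 : 0 < Real.log R / Real.log D := div_pos hlogR hlogD
  have hκ1 : Real.log R / Real.log D ≤ 1 := (div_le_one hlogD).mpr (Real.log_le_log (by linarith) hRD)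
  have hfint := hψ.integrable_cutoffFourier hκ0 hκ1
  -- `β_{s_t}(n)` is a finite sum of bounded continuous functions of `t`
  have hcont : Continuous fun t : ℝ => betaAF χ (⌊R⌋₊ + 1) (sParam R t) n := by
    have : (fun t : ℝ => betaAF χ (⌊R⌋₊ + 1) (sParam R t) n) = fun t => ∑ p ∈ n.divisorsAntidiagonal,
        ((if p.1 ∈ (⌊R⌋₊ + 1).smoothNumbers then lamMuChi χ p.1 else 0 : ℝ) : ℂ) *
          (p.1 : ℂ) ^ sParam R t * (realChar χ p.2 : ℂ) := by
      funext t; exact betaAF_apply χ _ _ _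
    rw [this]
    refine continuous_finsetSum _ fun p hp => ?_
    have hp1 : p.1 ≠ 0 := left_ne_zero_of_mul (by
      rw [(Nat.mem_divisorsAntidiagonal.mp hp).1]; exact (Nat.mem_divisorsAntidiagonal.mp hp).2)
    exact (continuous_const.mul (continuous_natCast_cpow_sParam hp1 R)).mul continuous_const
  have hbound : ∀ t, ‖betaAF χ (⌊R⌋₊ + 1) (sParam R t) n‖ ≤
      ∑ p ∈ n.divisorsAntidiagonal, (#p.1.divisors : ℝ) * (p.1 : ℝ) ^ (1 / Real.log R) := by
    intro t
    rw [betaAF_apply]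
    refine (norm_sum_le _ _).trans (Finset.sum_le_sum fun p hp => ?_)
    have hp1 : p.1 ≠ 0 := left_ne_zero_of_mul (by
      rw [(Nat.mem_divisorsAntidiagonal.mp hp).1]; exact (Nat.mem_divisorsAntidiagonal.mp hp).2)
    rw [norm_mul, norm_mul, norm_natCast_cpow_of_ne_zero hp1, sParam_re]
    have h1 : ‖((if p.1 ∈ (⌊R⌋₊ + 1).smoothNumbers then lamMuChi χ p.1 else 0 : ℝ) : ℂ)‖ ≤
        #p.1.divisors := by
      rw [Complex.norm_real, Real.norm_eq_abs]
      split_ifs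
      · exact abs_lamMuChi_le χ p.1
      · rw [abs_zero]; positivity
    have h2 := norm_realChar_le_one χ p.2
    calc ‖((if p.1 ∈ (⌊R⌋₊ + 1).smoothNumbers then lamMuChi χ p.1 else 0 : ℝ) : ℂ)‖ *
          (p.1 : ℝ) ^ (1 / Real.log R) * ‖(realChar χ p.2 : ℂ)‖
        ≤ #p.1.divisors * (p.1 : ℝ) ^ (1 / Real.log R) * 1 := by gcongr
      _ = _ := mul_one _
  exact hfint.bdd_mul hcont.aestronglyMeasurable (Filter.Eventually.of_forall hbound)

/-- **`|λ♭_Siegel(n)| ≤ ∫ ‖β_{s_t}(n)‖ ‖f(t)‖ dt`** ("from (6.7) and the triangle inequality"), for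
`1 < R ≤ D` and quadratic `χ`. [cite: TaoTeravainen2021, §6, proof of Lemma 6.1 (the display after (6.11))] -/
theorem abs_liouvilleSiegelFlat_le_integral (hψ : IsSmoothCutoff ψ) {R D : ℝ} (hR : 1 < R)
    (hRD : R ≤ D) (n : ℕ) :
    |liouvilleSiegelFlat χ ψ R D n| ≤
      ∫ t : ℝ, ‖betaAF χ (⌊R⌋₊ + 1) (sParam R t) n‖ *
        ‖cutoffFourier ψ (Real.log R / Real.log D) t‖ := by
  have h := liouvilleSiegelFlat_eq_integral χ hψ hR hRD n
  have hn : |liouvilleSiegelFlat χ ψ R D n| = ‖((liouvilleSiegelFlat χ ψ R D n : ℝ) : ℂ)‖ := by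
    rw [Complex.norm_real, Real.norm_eq_abs]
  rw [hn, h]
  refine (norm_integral_le_integral_norm _).trans (le_of_eq ?_)
  exact integral_congr_ae (Filter.Eventually.of_forall fun t => norm_mul _ _)

/-- The majorant integrand is integrable. [cite: TaoTeravainen2021, §6 (6.10)–(6.11)] -/
theorem integrable_norm_betaAF_mul_norm (hψ : IsSmoothCutoff ψ) {R D : ℝ} (hR : 1 < R)
    (hRD : R ≤ D) (n : ℕ) :
    Integrable fun t : ℝ => ‖betaAF χ (⌊R⌋₊ + 1) (sParam R t) n‖ *
      ‖cutoffFourier ψ (Real.log R / Real.log D) t‖ := by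
  have h := (integrable_norm_betaAF_mul χ hψ hR hRD n).norm
  refine h.congr (Filter.Eventually.of_forall fun t => ?_)
  exact norm_mul _ _

/-! ### `‖β_s(n)‖` as a product over prime powers -/

/-- **Multiplicativity in use**: `‖β_s(n)‖ = ∏_{p ∣ n} ‖β_s(p^{v_p(n)})‖` for `n ≥ 1` and
quadratic `χ` ("The function `|β_t|` is multiplicative").
[cite: TaoTeravainen2021, §6, proof of Lemma 6.1 (after (6.11))] -/
theorem norm_betaAF_eq_prod (hχ : χ.IsQuadratic) (N : ℕ) (s : ℂ) {n : ℕ} (hn : n ≠ 0) :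
    ‖betaAF χ N s n‖ = ∏ p ∈ n.primeFactors, ‖betaAF χ N s (p ^ n.factorization p)‖ := by
  rw [ArithmeticFunction.IsMultiplicative.multiplicative_factorization _
      (isMultiplicative_betaAF χ hχ N s) hn,
    Finsupp.prod, Nat.support_factorization, norm_prod]

end Literature.Barriers.Parity.TaoTeravainen
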